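import Summits.ABC.ABC.Theses.DefiniteXi
import Summits.ABC.ABC.Theses.RibetTakahashiSplit
import Summits.ABC.ABC.Theorems.IsogenyGlueCongruenceMazurKenkuBoundOfRadius
import Summits.ABC.ABC.Theorems.IsogenyGlueCongruenceMazurKenkuBoundLevelThirtyTwo
import Literature.NumberTheory.EllipticCurves.TakahashiDegreeFormulaCoprimeProofs
import Literature.NumberTheory.EllipticCurves.PastenSpectralDegree
import Literature.NumberTheory.EllipticCurves.PastenHeightBounds
import Literature.NumberTheory.EllipticCurves.PastenHeightBoundsLemma68LocalProofs
import Literature.NumberTheory.EllipticCurves.OpenImageMazurAssemblyProofs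
import Literature.NumberTheory.EllipticCurves.OpenImageMazurAdditiveProofs
import Literature.NumberTheory.EllipticCurves.OpenImageMazurNumericsProofs
import Literature.NumberTheory.EllipticCurves.SemistableModPImageReducibleProofs
import Literature.NumberTheory.EllipticCurves.RationalIsogenyDegreesProofs
import Literature.NumberTheory.EllipticCurves.IsogenyFrobeniusTraceProofs
import HarnessLib

/-!
# Stub-ideation k=1 for `stub_pasten163` (crux `DefiniteRTControlPrime`, route DefiniteXi)

Scratch check that the helper-lemma statements of `STUB-IDEAS-stub_pasten163-1.md` elaborate.
Plan A = recognise & import (the stub IS the shared item `IsogenyGlueCongruence.MazurKenkuBound`);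
Plan B = use the idle `C·N^ε` slack of the crux: a Mazur/Kenku-free *isogeny diameter* of the Frey
class, `≪_ε N^ε`, replaces the constant `163` (helpers H1–H8 below, sorried).
-/

namespace Summit.ABC.ABC.Cruxes.DefiniteRTControlPrime.Sketch.Ideas1

open Summit.ABC.ABC.Theses.DefiniteXi
open Literature.NumberTheory.EllipticCurves Literature.NumberTheory.EllipticCurves.ModularForms
open Literature.NumberTheory.Automorphic
open WeierstrassCurve IsDedekindDomain NumberField

/-! ## Plan A — the stub is, verbatim, the shared item `MazurKenkuBound` (stmt-ABC-15125) -/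

example : Summit.ABC.ABC.Theses.IsogenyGlueCongruence.MazurKenkuBound ↔
    PastenShimura2024_minimalDegree_le_163_mul := Iff.rfl

/-- Plan A import: the stub from the radius item alone (landed `mazurKenkuBound_of_radiusItem`,
Edixhoven integrality already discharged). -/
theorem stub_pasten163_of_radius
    (hRad : Summit.ABC.ABC.Theses.RibetTakahashiSplit.MazurKenkuRadius) :
    PastenShimura2024_minimalDegree_le_163_mul :=
  Summit.ABC.ABC.Theorems.mazurKenkuBound_of_radiusItem hRad

/-! ## Plan B — replace `163` by the isogeny diameter of the Frey class (uses the `N^ε` slack) -/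

/-- B0. The replacement input: every cyclic `ℚ`-isogeny between two curves of the isogeny class
of the Frey curve has degree `≪_ε N^ε` (in fact `≤ 16·n(p₀)³·n(p₁)³`, sub-polynomial in `N`). -/
def FreyIsogenyDiameter : Prop :=
  ∀ ε : ℝ, 0 < ε → ∃ C : ℝ, ∀ a b : ℤ, IsCoprime a b → a * b * (a + b) ≠ 0 →
    ∀ (W₁ W₂ : WeierstrassCurve ℚ) [W₁.IsElliptic] [W₂.IsElliptic],
      (freyCurve a b).IsIsogenous W₁ → (freyCurve a b).IsIsogenous W₂ →
      ∀ φ : Isogeny W₁ W₂, φ.IsCyclic →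
        (φ.degree : ℝ) ≤ C * (((freyCurve a b).conductorNorm ℤ : ℕ) : ℝ) ^ ε

/-- H1 (parametric `h163`, copy of `mazurKenkuBound_of_radiusItem_of_edixhovenItem` /
`exists_int_ker_le_163_of_radius…` / `PastenShimura2024_minimalDegree_le_163_mul_of` with
`163 ↦ B`, pointwise in `W'`, radius restricted to the class of `W'`). -/
theorem modularDegree_le_mul_of_classRadius (B : ℕ) {N : ℕ} [NeZero N]
    (W W' : WeierstrassCurve ℚ) [W.IsElliptic] [W'.IsElliptic] [W'.IsGloballyMinimal]
    (hRad : ∀ (W₀ : WeierstrassCurve ℚ) [W₀.IsElliptic], W₀.IsIsogenous W' →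
      ∃ φ : Isogeny W₀ W', φ.degree ≤ B)
    (D : ModularParametrizationData W N) (D' : ModularParametrizationData W' N) (hf : D'.f = D.f)
    (hD : ∀ (W'' : WeierstrassCurve ℚ) [W''.IsElliptic] (D'' : ModularParametrizationData W'' N),
      D''.f = D.f → D.modularDegree ≤ D''.modularDegree)
    (hD' : ∀ D'' : ModularParametrizationData W' N, D'.modularDegree ≤ D''.modularDegree) :
    D'.modularDegree ≤ B * D.modularDegree := by
  sorry

/-- H2 (parametric `hval`, copy of `stub_valTransport` with Lemma 6.8 replaced by the tree's
`exists_ordMinimalDiscriminant_mul_eq_mul_of_isCyclic`). -/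
theorem factorization_minimalDiscriminantNorm_le_of_isogeny (B : ℕ) (a b : ℤ)
    (hab : IsCoprime a b) (h0 : a * b * (a + b) ≠ 0) (q : ℕ) (hq : q.Prime) (hq2 : q ≠ 2)
    (hqN : q ∣ (freyCurve a b).conductorNorm ℤ) (W' : WeierstrassCurve ℚ) [W'.IsElliptic]
    (φ : Isogeny (freyCurve a b) W') (hφ : φ.IsCyclic) (hB : φ.degree ≤ B) :
    (W'.minimalDiscriminantNorm ℤ).factorization q ≤
      B * ((freyCurve a b).minimalDiscriminantNorm ℤ).factorization q := by
  sorry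

/-- H3 (2-part ≤ 16: landed level `32` + sub-isogenies of cyclic isogenies). -/
theorem not_thirtyTwo_dvd_degree_of_isCyclic {V V' : WeierstrassCurve ℚ} [V.IsElliptic]
    [V'.IsElliptic] (ψ : Isogeny V V') (hψ : ψ.IsCyclic) : ¬ 32 ∣ ψ.degree := by
  intro h
  obtain ⟨V'', hV'', χ, hχ, hdeg, -⟩ := ψ.exists_isCyclic_degree_eq_of_dvd hψ h
  haveI := hV''
  exact Summit.ABC.ABC.Theorems.isogeny_isCyclic_degree_ne_thirtyTwo χ hχ hdeg

/-- H4 (level 1 — odd primes dividing a cyclic degree; ASSEMBLY of tree theorems: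
`Mazur1978.exists_isogenyCharacter`, `exists_forall_isogenyCharacter_eq_mul_pow` (normal form
`r = b·χ̄ᵏ`, `b¹² = 1`, unconditional), `modEq_zero_or_one_of_hasMultiplicativeReductionAt` /
`Mazur1978.modEq_zero_or_one_of_hasGoodReductionAtPrime` (`k ≡ 0,1`), and Cor. 6.1 (2)
`isogenyCharacter_sq_sub_frobeniusTrace_mul_add_eq_zero` / `congruences_of_eq_mul_pow`). -/
theorem prime_dvd_frobNorm_of_stableLine (W₁ : WeierstrassCurve ℚ) [W₁.IsElliptic]
    [W₁.IsGloballyMinimal] (ℓ : ℕ) [Fact ℓ.Prime] (hℓ2 : ℓ ≠ 2)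
    (hss : ∀ v : HeightOneSpectrum (𝓞 ℚ), (ℓ : 𝓞 ℚ) ∈ v.asIdeal → W₁.IsSemistableAt v)
    {P : geomTorsion W₁ ℓ} (hP0 : P ≠ 0)
    (hst : ∀ σ : Field.absoluteGaloisGroup ℚ, σ • P ∈ AddSubgroup.zmultiples P)
    (p : ℕ) [Fact p.Prime] (hp2 : p ≠ 2) (hpℓ : p ≠ ℓ) (hgood : W₁.HasGoodReductionAtPrime p) :
    (ℓ : ℤ) ∣ (p : ℤ) ^ 12 + 1 - Mazur1978.frobTracePow (W₁.frobeniusTrace p) p 12 := by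
  sorry

/-- H5 (level `ℓᵏ` — the one NEW input, controls exponents: a *split* pair of stable cyclic
subgroups of order `ℓᵏ` forces `ℓᵏ ∣ n(p)`; same chain as H4 mod `ℓᵏ`, the splitting replacing
Mazur's Lemma 5.2/5.3 at `ℓ` and at the potentially multiplicative place `2`). -/
theorem primePow_dvd_frobNorm_of_split (W₁ : WeierstrassCurve ℚ) [W₁.IsElliptic]
    [W₁.IsGloballyMinimal] (ℓ k : ℕ) [Fact ℓ.Prime] (hℓ2 : ℓ ≠ 2)
    (hss : ∀ v : HeightOneSpectrum (𝓞 ℚ), (2 : 𝓞 ℚ) ∉ v.asIdeal → W₁.IsSemistableAt v)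
    (A B : AddSubgroup (geomPoints W₁)) (hA : A ≤ geomTorsion W₁ ((ℓ : ℤ) ^ k))
    (hB : B ≤ geomTorsion W₁ ((ℓ : ℤ) ^ k)) (hAc : IsAddCyclic A) (hBc : IsAddCyclic B)
    (hAcard : Nat.card A = ℓ ^ k) (hBcard : Nat.card B = ℓ ^ k) (hAB : A ⊓ B = ⊥)
    (hAst : ∀ σ : Field.absoluteGaloisGroup ℚ, ∀ Q : geomPoints W₁, Q ∈ A → σ • Q ∈ A)
    (hBst : ∀ σ : Field.absoluteGaloisGroup ℚ, ∀ Q : geomPoints W₁, Q ∈ B → σ • Q ∈ B)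
    (p : ℕ) [Fact p.Prime] (hp2 : p ≠ 2) (hpℓ : p ≠ ℓ) (hgood : W₁.HasGoodReductionAtPrime p) :
    ((ℓ : ℤ) ^ k) ∣ (p : ℤ) ^ 12 + 1 - Mazur1978.frobTracePow (W₁.frobeniusTrace p) p 12 := by
  sorry

/-- H6 (middle curve: a cyclic isogeny of degree divisible by `ℓ^{2k}` inside a class yields a
curve of the class with a SPLIT pair of stable cyclic subgroups of order `ℓᵏ`; from
`Isogeny.exists_isCyclic_degree_eq_of_dvd` + factorisation through the quotient). -/
theorem exists_split_of_isCyclic {W₁ W₂ : WeierstrassCurve ℚ} [W₁.IsElliptic] [W₂.IsElliptic]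
    (φ : Isogeny W₁ W₂) (hφ : φ.IsCyclic) (ℓ k : ℕ) [Fact ℓ.Prime] (hdiv : ℓ ^ (2 * k) ∣ φ.degree) :
    ∃ (W' : WeierstrassCurve ℚ) (_ : W'.IsElliptic), W₁.IsIsogenous W' ∧
      ∃ A B : AddSubgroup (geomPoints W'), A ≤ geomTorsion W' ((ℓ : ℤ) ^ k) ∧
        B ≤ geomTorsion W' ((ℓ : ℤ) ^ k) ∧ IsAddCyclic A ∧ IsAddCyclic B ∧
        Nat.card A = ℓ ^ k ∧ Nat.card B = ℓ ^ k ∧ A ⊓ B = ⊥ ∧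
        (∀ σ : Field.absoluteGaloisGroup ℚ, ∀ Q : geomPoints W', Q ∈ A → σ • Q ∈ A) ∧
        (∀ σ : Field.absoluteGaloisGroup ℚ, ∀ Q : geomPoints W', Q ∈ B → σ • Q ∈ B) := by
  sorry

/-- H7 (size of `n(p)`: Hasse ⇒ reciprocal roots of absolute value `√p`; via the cast to the
complex `frobTracePow` and `norm_frobTracePow_le_of_sq_le`). -/
theorem frobNorm_pos_and_le (p : ℕ) (t : ℤ) (ht : t ^ 2 ≤ 4 * p) :
    0 < (p : ℤ) ^ 12 + 1 - Mazur1978.frobTracePow t p 12 ∧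
      (p : ℤ) ^ 12 + 1 - Mazur1978.frobTracePow t p 12 ≤ ((p : ℤ) ^ 6 + 1) ^ 2 := by
  sorry

/-- H8 (two small odd primes of good reduction: Bertrand only — a prime in every dyadic interval
makes the primorial super-polynomial, so the two least odd primes `∤ N` are `≪_δ N^δ`). -/
theorem exists_two_odd_primes_not_dvd (δ : ℝ) (hδ : 0 < δ) :
    ∃ C : ℝ, ∀ N : ℕ, 0 < N → ∃ p₀ p₁ : ℕ, p₀.Prime ∧ p₁.Prime ∧ p₀ ≠ 2 ∧ p₁ ≠ 2 ∧ p₀ ≠ p₁ ∧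
      ¬ p₀ ∣ N ∧ ¬ p₁ ∣ N ∧ (p₀ : ℝ) ≤ C * (N : ℝ) ^ δ ∧ (p₁ : ℝ) ≤ C * (N : ℝ) ^ δ := by
  sorry

/-- ASSEMBLY of Plan B's input: H3–H8 ⇒ B0 (cyclic degree `= 2^a·∏ ℓᵢ^{eᵢ}` with `2^a ≤ 16`,
`ℓᵢ^{eᵢ} ∣ ℓᵢ·(ℓᵢ^{⌊eᵢ/2⌋})² ∣ n(p)³` for `p ∈ {p₀,p₁} ∖ {ℓᵢ}`, `n(p) ≤ (p⁶+1)²`, `p ≪ N^δ`). -/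
theorem freyIsogenyDiameter_of : FreyIsogenyDiameter := by
  sorry

/-- RESHAPED COMPOSITION (replaces `h163` by H1 at `W_m` and `hval` by H2 at `W⋆`, both fed by B0
with `B = ⌊C(ε/2)·N^{ε/2}⌋`; the crux constant becomes `4·C(ε/2)²`). -/
theorem definiteRTControlPrime_of_diameter
    (hT : takahashi2001_thm_2_3_of_coprime) (hDiam : FreyIsogenyDiameter) :
    DefiniteRTControlPrime := by
  sorry

end Summit.ABC.ABC.Cruxes.DefiniteRTControlPrime.Sketch.Ideas1
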